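import Summits.AtomisticToContinuum.Crystallization.Theorems.ReggeStarCoercivityStarCoercivityCoarseTierTransfer

/-!
# Crux `GappedShellCensus.RadialDefectsVanish` (stmt-AtomisticToContinuum-15930), line `Sketch` —
# stub `stub_rdvSeparatedPoints` (S, bookkeeping: the periodisation is `δ`-separated)

Setting: a finite configuration `x : Fin N → ℝ³` and a periodic configuration `P` of `ℝ³` with
motif `univ.image x` all of whose non-zero periods have length `≥ 2Σ‖x k‖ + 2`
(`CoarseTierTransfer.exists_periodicConfiguration`).  Claim: if `x` is `δ`-separated with
`δ ≤ 2`, then `P.points` is `δ`-separated.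

Proof (verbatim generalisation of the tree lemma `CoarseTierTransfer.separated_points`, the case
`δ = 1/3`).  Two distinct points `xᵢ + g` (`g` a period) and `v` of `P`: translating by `−g`,
`dist (xᵢ + g) v = dist xᵢ (v − g)` with `v − g ∈ P.points`; either `v − g = xⱼ` with `j ≠ i`
(distance `≥ δ` by separation of `x`), or `v − g` is none of the `xⱼ` and lies at distance `≥ 2 ≥ δ`
from `xᵢ` (`CoarseTierTransfer.two_le_dist_of_mem_points`).  Imports: the tree module only; no
named fact, no definition.
-/

noncomputable section

open scoped BigOperators Classical

namespace Summit.AtomisticToContinuum.Crystallization.Theorems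

open Literature.MathematicalPhysics.StatisticalMechanics

-- adapted from Summits/.../ReggeStarCoercivityStarCoercivityCoarseTierTransfer.lean (separated_points)

/-- **Stub S (bookkeeping).** The long-period periodisation of a `δ`-separated finite
configuration (`δ ≤ 2`) has `δ`-separated points: two distinct points `xᵢ + g`, `v` are, after
translating by `−g`, either `xᵢ, xⱼ` with `i ≠ j` (distance `≥ δ`) or `xᵢ` and a foreign point
(distance `≥ 2 ≥ δ`, `CoarseTierTransfer.two_le_dist_of_mem_points`). [folklore] -/
theorem stub_rdvSeparatedPoints {N : ℕ} {x : Fin N → EuclideanSpace ℝ (Fin 3)}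
    {P : PeriodicConfiguration 3} (hPm : P.motif = Finset.univ.image x)
    (hPl : ∀ g ∈ P.lattice, g ≠ 0 → 2 * ∑ k, ‖x k‖ + 2 ≤ ‖g‖) {δ : ℝ} (hδ2 : δ ≤ 2)
    (hsep : ∀ i j : Fin N, i ≠ j → δ ≤ dist (x i) (x j)) :
    ∀ u ∈ P.points, ∀ v ∈ P.points, u ≠ v → δ ≤ dist u v := by
  rintro u ⟨z, hz, g, hg, rfl⟩ v hv huv
  rw [hPm] at hz
  obtain ⟨i, -, rfl⟩ := Finset.mem_image.1 hz
  have hv' : v - g ∈ P.points := by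
    have h := P.add_mem_points hv (P.lattice.neg_mem hg)
    simpa [sub_eq_add_neg] using h
  have hdist : dist (x i + g) v = dist (x i) (v - g) := by
    rw [dist_eq_norm, dist_eq_norm]
    congr 1
    abel
  rw [hdist]
  by_cases h : ∃ j, v - g = x j
  · obtain ⟨j, hj⟩ := h
    rw [hj]
    refine hsep i j ?_
    rintro rfl
    exact huv (sub_eq_iff_eq_add.1 hj).symm
  · push Not at h
    have h2 := CoarseTierTransfer.two_le_dist_of_mem_points hPm hPl i hv' h
    linarith

end Summit.AtomisticToContinuum.Crystallization.Theorems
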